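import Mathlib
import Summits.AtomisticToContinuum.Crystallization.Theses.InterfaceTextureTrichotomy
import Summits.AtomisticToContinuum.Crystallization.Theses.TemplateTcpTrichotomy
import Summits.AtomisticToContinuum.Crystallization.Theses.CoarseDensityTrichotomy

/-!
# InterfaceTextureTrichotomy — the nodule-bulk split of the composite cell (decomp-a2c lens-2, generation 10)

Tree twin of the cell node «NoduleBulkTrichotomy» (run/shared/lean/pub/decomp-a2c/decomp-a2c-lens-2/g10/NoduleBulkTrichotomy.lean,
sha256 recorded on the cell bus).  Sorry-free, no new definitions.

* `compositeTextureCaseGlue_proof` — PROVES the split glue item `InterfaceTextureTrichotomy.CompositeTextureCaseGlue`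
  (stmt-AtomisticToContinuum-33647): `TexturedGrainCase → IrregularGrainCase → MesoscopicCompositeCase → CompositeTextureCase`
  (excluded middle on «certified-template OR solid all-tcp all-bad balls of every radius recur», then on «all-coarse balls of every
  radius recur»; the children (stmt-33644/5/6) carry COMPACT let-hoisted texts, definitionally equal to the parent's expanded vocabulary).
* `compositeTextureCase_iff_children` — the node is EXACT: `CompositeTextureCase ↔ K₁ ∧ K₂ ∧ K₃` (stmt-28575 ⟺ 33644 ∧ 33645 ∧ 33646).
* `texturedGrainCase_of_exclusions` — K₁ (stmt-33644) is VACUOUS given the coarse-majority branch's two finite-N exclusions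
  (certified-crystallite exclusion = the conclusion of P1*'s registered door `stub_parametricBookkeeping`, stmt-33209; solid-all-tcp
  exclusion at any radius ℓ = the conclusion of W's registered door `stub_tcpBookkeeping`, stmt-33336): the doors are AMBIENT-FREE.
* `tBranch_of_exclusions` — the SAME two exclusions close the T-branch items `TemplateTcpTrichotomy.CertifiedTemplateCase` and
  `TemplateTcpTrichotomy.TcpNetworkCase` by name: one proof of the doors closes three cells of two branches.
* `coarseMinorityBulkCase_of_children`, `crystallization_of_children` — M (stmt-27743) and the conjunct from the refined cell list
  (the route's deciding theorem `InterfaceTextureTrichotomy.closes` with C rebuilt from its children).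
-/

namespace Summit.AtomisticToContinuum.Crystallization.Theorems.InterfaceTextureTrichotomyNoduleBulk

/-- the split glue (stmt-AtomisticToContinuum-33647): children ⟹ parent, by excluded middle twice. -/
theorem compositeTextureCaseGlue_proof : Theses.InterfaceTextureTrichotomy.CompositeTextureCaseGlue := by
  intro h₁ h₂ h₃ x hx h₂' h₅₀ hH hT
  refine (Classical.em _).elim (fun ht => h₁ x hx h₂' h₅₀ hH hT ht) (fun hn => ?_)
  exact (Classical.em _).elim (fun hg => h₂ x hx h₂' h₅₀ hH hT (fun hc => hn (Or.inl hc)) (fun hw => hn (Or.inr hw)) hg)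
    (fun hg => h₃ x hx h₂' h₅₀ hH hT (fun hc => hn (Or.inl hc)) (fun hw => hn (Or.inr hw)) hg)

/-- children ⟹ parent (the glue, curried). -/
theorem compositeTextureCase_of_children (h₁ : Theses.InterfaceTextureTrichotomy.TexturedGrainCase) (h₂ : Theses.InterfaceTextureTrichotomy.IrregularGrainCase)
    (h₃ : Theses.InterfaceTextureTrichotomy.MesoscopicCompositeCase) : Theses.InterfaceTextureTrichotomy.CompositeTextureCase :=
  compositeTextureCaseGlue_proof h₁ h₂ h₃

/-- parent ⟹ K₁ (K₁ is C with one extra hypothesis). -/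
theorem texturedGrainCase_of_compositeTextureCase (h : Theses.InterfaceTextureTrichotomy.CompositeTextureCase) : Theses.InterfaceTextureTrichotomy.TexturedGrainCase :=
  fun x hx h₂ h₅₀ hH hT _ => h x hx h₂ h₅₀ hH hT

/-- parent ⟹ K₂. -/
theorem irregularGrainCase_of_compositeTextureCase (h : Theses.InterfaceTextureTrichotomy.CompositeTextureCase) : Theses.InterfaceTextureTrichotomy.IrregularGrainCase :=
  fun x hx h₂ h₅₀ hH hT _ _ _ => h x hx h₂ h₅₀ hH hT

/-- parent ⟹ K₃. -/
theorem mesoscopicCompositeCase_of_compositeTextureCase (h : Theses.InterfaceTextureTrichotomy.CompositeTextureCase) : Theses.InterfaceTextureTrichotomy.MesoscopicCompositeCase :=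
  fun x hx h₂ h₅₀ hH hT _ _ _ => h x hx h₂ h₅₀ hH hT

/-- **EXACTNESS**: the parent cell C (stmt-28575) is equivalent to the conjunction of its three children (stmt-33644/5/6). -/
theorem compositeTextureCase_iff_children :
    Theses.InterfaceTextureTrichotomy.CompositeTextureCase ↔ (Theses.InterfaceTextureTrichotomy.TexturedGrainCase ∧ Theses.InterfaceTextureTrichotomy.IrregularGrainCase ∧ Theses.InterfaceTextureTrichotomy.MesoscopicCompositeCase) :=
  ⟨fun h => ⟨texturedGrainCase_of_compositeTextureCase h, irregularGrainCase_of_compositeTextureCase h,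
      mesoscopicCompositeCase_of_compositeTextureCase h⟩,
    fun h => compositeTextureCase_of_children h.1 h.2.1 h.2.2⟩

/-- K₁ (stmt-33644) is VACUOUS given the two finite-N exclusions of the coarse-majority branch's doors: no certified crystallite of any
admissible template in any Lennard-Jones ground state (the conclusion of `stub_parametricBookkeeping`), and, for some radius ℓ, no particle
whose closed ℓ-ball is solid and all-tcp (the conclusion of `stub_tcpBookkeeping` at any cube certificate).  The composition never touches
the ambient hypotheses 𝔊_(1/2), ¬𝔊_(1/50), ¬ℌ, ¬𝔗 — the doors are ambient-free. -/
theorem texturedGrainCase_of_exclusions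
    (hY : ∀ (N : ℕ) (y : Fin N → EuclideanSpace ℝ (Fin 3)), Literature.MathematicalPhysics.StatisticalMechanics.IsGroundState Literature.MathematicalPhysics.StatisticalMechanics.lennardJones y → ∀ j : Fin N, ¬ (∃ b : Fin 3 → EuclideanSpace ℝ (Fin 3), ∃ M : Finset (EuclideanSpace ℝ (Fin 3)), ∃ κ D : ℝ, 0 < κ ∧ (∀ i : Fin 3, ‖b i‖ ≤ D) ∧ (∀ m ∈ M, ‖m‖ ≤ D) ∧ (∀ w w' : Fin 3 → ℤ, ∀ m ∈ M, ∀ m' ∈ M, (w ≠ w' ∨ m ≠ m') → (1 / 2 : ℝ) ≤ dist ((∑ i : Fin 3, ((w i : ℤ) : ℝ) • b i) + m) ((∑ i : Fin 3, ((w' i : ℤ) : ℝ) • b i) + m')) ∧ (∃ K : ℕ, (∀ m ∈ M, ∀ m' ∈ M, ∀ w : Fin 3 → ℤ, ‖(∑ i : Fin 3, ((w i : ℤ) : ℝ) • b i) + m' - m‖ ≤ 8 → ∀ i : Fin 3, |w i| ≤ (K : ℤ)) ∧ (let Vrob : ℝ → ℝ := fun r : ℝ => if r + 1 / 500 ≤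 1 then Literature.MathematicalPhysics.StatisticalMechanics.lennardJones (r + 1 / 500) else if 1 ≤ r - 1 / 500 then Literature.MathematicalPhysics.StatisticalMechanics.lennardJones (r - 1 / 500) else -(1 / 12 : ℝ); ((M).card : ℝ) * (2 * (-(179 : ℝ) / 250) + 1 / 75) + κ * |Matrix.det (Matrix.of fun i j : Fin 3 => (b i) j)| ≤ ∑ m ∈ M, ∑ w ∈ Fintype.piFinset (fun _ : Fin 3 => Finset.Icc (-(K : ℤ)) K), ∑ m' ∈ M, (let v : EuclideanSpace ℝ (Fin 3) := (∑ i : Fin 3, ((w i : ℤ) : ℝ) • b i) + m' - m; if 0 < ‖v‖ ∧ ‖v‖ ≤ 8 then Vrob ‖v‖ else 0))) ∧ ∃ t : EuclideanSpace ℝ (Fin 3), let S : Set (EuclideanSpace ℝ (Fin 3)) := {p : EuclideanSpace ℝ (Fin 3) | ∃ w : Fin 3 → ℤ, ∃ m ∈ M, p = (∑ i : Fin 3, ((w i : ℤ) : ℝ) • b i) + m + t}; let ℓ : ℝ := 10000 * (1 + D) * (1 + 1 / κ); (∀ p ∈ S, dist p (y j) ≤ ℓ → ∃ k : Fin N, dist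 (y k) p ≤ 1 / 1000) ∧ (∀ k : Fin N, dist (y k) (y j) ≤ ℓ → ∃ p ∈ S, dist (y k) p ≤ 1 / 1000)))
    (ℓ : ℝ) (hW : ∀ (N : ℕ) (y : Fin N → EuclideanSpace ℝ (Fin 3)), Literature.MathematicalPhysics.StatisticalMechanics.IsGroundState Literature.MathematicalPhysics.StatisticalMechanics.lennardJones y → ∀ i : Fin N, ¬ ((∀ z : EuclideanSpace ℝ (Fin 3), dist z (y i) ≤ ℓ → ∃ k : Fin N, dist z (y k) ≤ 1) ∧ (∀ j : Fin N, dist (y j) (y i) ≤ ℓ → (let d : ℝ := sInf ((fun z => dist z (y j)) '' (Set.range (y) \ {(y j)})); ∀ k : Fin N, y k ≠ y j → dist (y k) (y j) < 27 / 20 * d → 5 ≤ Nat.card {m : Fin N // y m ≠ y j ∧ dist (y m) (y j) < 27 / 20 * d ∧ y m ≠ y k ∧ dist (y m) (y k) < 27 / 20 * d})))) :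
    Theses.InterfaceTextureTrichotomy.TexturedGrainCase := by
  intro x Gd Nd hx _ _ _ _ ht
  rcases ht with hc | hw
  · obtain ⟨N, i, -, hi⟩ := (hc 0).exists
    exact (hY N (x N) (hx N) i hi).elim
  · obtain ⟨N, i, -, hs, ha⟩ := (hw ℓ).exists
    exact (hW N (x N) (hx N) i ⟨hs, ha⟩).elim

/-- … and the SAME two exclusions close the coarse-majority branch's items P1* (stmt-33209) and W (stmt-33336) BY NAME. -/
theorem tBranch_of_exclusions
    (hY : ∀ (N : ℕ) (y : Fin N → EuclideanSpace ℝ (Fin 3)), Literature.MathematicalPhysics.StatisticalMechanics.IsGroundState Literature.MathematicalPhysics.StatisticalMechanics.lennardJones y → ∀ j : Fin N, ¬ (∃ b : Fin 3 → EuclideanSpace ℝ (Fin 3), ∃ M : Finset (EuclideanSpace ℝ (Fin 3)), ∃ κ D : ℝ, 0 < κ ∧ (∀ i : Fin 3, ‖b i‖ ≤ D) ∧ (∀ m ∈ M, ‖m‖ ≤ D) ∧ (∀ w w' : Fin 3 → ℤ, ∀ m ∈ M, ∀ m' ∈ M, (w ≠ w' ∨ m ≠ m') → (1 / 2 : ℝ)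 ≤ dist ((∑ i : Fin 3, ((w i : ℤ) : ℝ) • b i) + m) ((∑ i : Fin 3, ((w' i : ℤ) : ℝ) • b i) + m')) ∧ (∃ K : ℕ, (∀ m ∈ M, ∀ m' ∈ M, ∀ w : Fin 3 → ℤ, ‖(∑ i : Fin 3, ((w i : ℤ) : ℝ) • b i) + m' - m‖ ≤ 8 → ∀ i : Fin 3, |w i| ≤ (K : ℤ)) ∧ (let Vrob : ℝ → ℝ := fun r : ℝ => if r + 1 / 500 ≤ 1 then Literature.MathematicalPhysics.StatisticalMechanics.lennardJones (r + 1 / 500) else if 1 ≤ r - 1 / 500 then Literature.MathematicalPhysics.StatisticalMechanics.lennardJones (r - 1 / 500) else -(1 / 12 : ℝ); ((M).card : ℝ) * (2 * (-(179 : ℝ) / 250) + 1 / 75) + κ * |Matrix.det (Matrix.of fun i j : Fin 3 => (b i) j)| ≤ ∑ m ∈ M, ∑ w ∈ Fintype.piFinset (fun _ : Fin 3 => Finset.Icc (-(K : ℤ)) K), ∑ m' ∈ M, (let v : EuclideanSpace ℝ (Fin 3) := (∑ i : Fin 3, ((w i : ℤ) : ℝ) • b i) + m' - m; if 0 < ‖v‖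 ∧ ‖v‖ ≤ 8 then Vrob ‖v‖ else 0))) ∧ ∃ t : EuclideanSpace ℝ (Fin 3), let S : Set (EuclideanSpace ℝ (Fin 3)) := {p : EuclideanSpace ℝ (Fin 3) | ∃ w : Fin 3 → ℤ, ∃ m ∈ M, p = (∑ i : Fin 3, ((w i : ℤ) : ℝ) • b i) + m + t}; let ℓ : ℝ := 10000 * (1 + D) * (1 + 1 / κ); (∀ p ∈ S, dist p (y j) ≤ ℓ → ∃ k : Fin N, dist (y k) p ≤ 1 / 1000) ∧ (∀ k : Fin N, dist (y k) (y j) ≤ ℓ → ∃ p ∈ S, dist (y k) p ≤ 1 / 1000)))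
    (ℓ : ℝ) (hW : ∀ (N : ℕ) (y : Fin N → EuclideanSpace ℝ (Fin 3)), Literature.MathematicalPhysics.StatisticalMechanics.IsGroundState Literature.MathematicalPhysics.StatisticalMechanics.lennardJones y → ∀ i : Fin N, ¬ ((∀ z : EuclideanSpace ℝ (Fin 3), dist z (y i) ≤ ℓ → ∃ k : Fin N, dist z (y k) ≤ 1) ∧ (∀ j : Fin N, dist (y j) (y i) ≤ ℓ → (let d : ℝ := sInf ((fun z => dist z (y j)) '' (Set.range (y) \ {(y j)})); ∀ k : Fin N, y k ≠ y j → dist (y k) (y j) < 27 / 20 * d → 5 ≤ Nat.card {m : Fin N // y m ≠ y j ∧ dist (y m) (y j) < 27 / 20 * d ∧ y m ≠ y k ∧ dist (y m) (y k) < 27 / 20 * d})))) :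
    Theses.TemplateTcpTrichotomy.CertifiedTemplateCase ∧ Theses.TemplateTcpTrichotomy.TcpNetworkCase := by
  refine ⟨fun x hx _ _ hc => ?_, fun x hx _ _ hw => ?_⟩
  · obtain ⟨N, i, -, hi⟩ := (hc 0).exists
    exact (hY N (x N) (hx N) i hi).elim
  · obtain ⟨N, i, -, hs, ha⟩ := (hw ℓ).exists
    exact (hW N (x N) (hx N) i ⟨hs, ha⟩).elim

/-- GIVEN the two exclusions, C reduces to its grain-free children K₂ ∧ K₃. -/
theorem compositeTextureCase_of_exclusions
    (hY : ∀ (N : ℕ) (y : Fin N → EuclideanSpace ℝ (Fin 3)), Literature.MathematicalPhysics.StatisticalMechanics.IsGroundState Literature.MathematicalPhysics.StatisticalMechanics.lennardJones y → ∀ j : Fin N, ¬ (∃ b : Fin 3 → EuclideanSpace ℝ (Fin 3), ∃ M : Finset (EuclideanSpace ℝ (Fin 3)), ∃ κ D : ℝ, 0 < κ ∧ (∀ i : Fin 3, ‖b i‖ ≤ D) ∧ (∀ m ∈ M, ‖m‖ ≤ D) ∧ (∀ w w' : Fin 3 → ℤ, ∀ m ∈ M, ∀ m' ∈ M, (w ≠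 w' ∨ m ≠ m') → (1 / 2 : ℝ) ≤ dist ((∑ i : Fin 3, ((w i : ℤ) : ℝ) • b i) + m) ((∑ i : Fin 3, ((w' i : ℤ) : ℝ) • b i) + m')) ∧ (∃ K : ℕ, (∀ m ∈ M, ∀ m' ∈ M, ∀ w : Fin 3 → ℤ, ‖(∑ i : Fin 3, ((w i : ℤ) : ℝ) • b i) + m' - m‖ ≤ 8 → ∀ i : Fin 3, |w i| ≤ (K : ℤ)) ∧ (let Vrob : ℝ → ℝ := fun r : ℝ => if r + 1 / 500 ≤ 1 then Literature.MathematicalPhysics.StatisticalMechanics.lennardJones (r + 1 / 500) else if 1 ≤ r - 1 / 500 then Literature.MathematicalPhysics.StatisticalMechanics.lennardJones (r - 1 / 500) else -(1 / 12 : ℝ); ((M).card : ℝ) * (2 * (-(179 : ℝ) / 250) + 1 / 75) + κ * |Matrix.det (Matrix.of fun i j : Fin 3 => (b i) j)| ≤ ∑ m ∈ M, ∑ w ∈ Fintype.piFinset (fun _ : Fin 3 => Finset.Icc (-(K : ℤ)) K), ∑ m' ∈ M, (let v : EuclideanSpace ℝ (Fin 3) := (∑ i : Fin 3, ((w i : ℤ)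 : ℝ) • b i) + m' - m; if 0 < ‖v‖ ∧ ‖v‖ ≤ 8 then Vrob ‖v‖ else 0))) ∧ ∃ t : EuclideanSpace ℝ (Fin 3), let S : Set (EuclideanSpace ℝ (Fin 3)) := {p : EuclideanSpace ℝ (Fin 3) | ∃ w : Fin 3 → ℤ, ∃ m ∈ M, p = (∑ i : Fin 3, ((w i : ℤ) : ℝ) • b i) + m + t}; let ℓ : ℝ := 10000 * (1 + D) * (1 + 1 / κ); (∀ p ∈ S, dist p (y j) ≤ ℓ → ∃ k : Fin N, dist (y k) p ≤ 1 / 1000) ∧ (∀ k : Fin N, dist (y k) (y j) ≤ ℓ → ∃ p ∈ S, dist (y k) p ≤ 1 / 1000)))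
    (ℓ : ℝ) (hW : ∀ (N : ℕ) (y : Fin N → EuclideanSpace ℝ (Fin 3)), Literature.MathematicalPhysics.StatisticalMechanics.IsGroundState Literature.MathematicalPhysics.StatisticalMechanics.lennardJones y → ∀ i : Fin N, ¬ ((∀ z : EuclideanSpace ℝ (Fin 3), dist z (y i) ≤ ℓ → ∃ k : Fin N, dist z (y k) ≤ 1) ∧ (∀ j : Fin N, dist (y j) (y i) ≤ ℓ → (let d : ℝ := sInf ((fun z => dist z (y j)) '' (Set.range (y) \ {(y j)})); ∀ k : Fin N, y k ≠ y j → dist (y k) (y j) < 27 / 20 * d → 5 ≤ Nat.card {m : Fin N // y m ≠ y j ∧ dist (y m) (y j) < 27 / 20 * d ∧ y m ≠ y k ∧ dist (y m) (y k) < 27 / 20 * d}))))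
    (h₂ : Theses.InterfaceTextureTrichotomy.IrregularGrainCase) (h₃ : Theses.InterfaceTextureTrichotomy.MesoscopicCompositeCase) : Theses.InterfaceTextureTrichotomy.CompositeTextureCase :=
  compositeTextureCase_of_children (texturedGrainCase_of_exclusions hY ℓ hW) h₂ h₃

/-- any LOCAL exclusion of all-coarse ℓ-balls in ground states closes K₂ (stmt-33645): K₂ asks for nothing beyond the Z-programme of the
coarse-majority branch (TemplateTcpTrichotomy.IrregularCoarseCase, stmt-33337). -/
theorem irregularGrainCase_of_exclusion (ℓ : ℝ)
    (h : ∀ (N : ℕ) (y : Fin N → EuclideanSpace ℝ (Fin 3)), Literature.MathematicalPhysics.StatisticalMechanics.IsGroundState Literature.MathematicalPhysics.StatisticalMechanics.lennardJones y → ∀ i : Fin N, ¬ (∀ j : Fin N, dist (y j) (y i) ≤ ℓ → ¬ (let d : ℝ := sInf ((fun z => dist z (y j)) '' (Set.range (y) \ {(y j)})); let T : Set (EuclideanSpace ℝ (Fin 3)) := {z : EuclideanSpace ℝ (Fin 3) | z ∈ Set.range (y) ∧ z ≠ (y j) ∧ dist z (y j) < 13 / 10 * d}; ∃ A : EuclideanSpace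 ℝ (Fin 3) →ₗᵢ[ℝ] EuclideanSpace ℝ (Fin 3), (∃ e : ↥T ≃ ↥Literature.Geometry.DiscreteGeometry.fccKissingPattern, ∀ t : ↥T, dist (d⁻¹ • ((t : EuclideanSpace ℝ (Fin 3)) - (y j))) (A ((e t : ↥Literature.Geometry.DiscreteGeometry.fccKissingPattern) : EuclideanSpace ℝ (Fin 3))) ≤ 1 / 8) ∨ (∃ e : ↥T ≃ ↥Literature.Geometry.DiscreteGeometry.hcpKissingPattern, ∀ t : ↥T, dist (d⁻¹ • ((t : EuclideanSpace ℝ (Fin 3)) - (y j))) (A ((e t : ↥Literature.Geometry.DiscreteGeometry.hcpKissingPattern) : EuclideanSpace ℝ (Fin 3))) ≤ 1 / 8)))) :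
    Theses.InterfaceTextureTrichotomy.IrregularGrainCase := by
  intro x Gd Nd hx _ _ _ _ _ _ hn
  obtain ⟨N, i, hi⟩ := (hn ℓ).exists
  exact (h N (x N) (hx N) i hi).elim

/-- the grand-parent item M (CoarseDensityTrichotomy.CoarseMinorityBulkCase, stmt-27743) from the refined cell list G, A, K₁, K₂, K₃. -/
theorem coarseMinorityBulkCase_of_children (hG : Theses.InterfaceTextureTrichotomy.GrainyTextureCase) (hA : Theses.InterfaceTextureTrichotomy.ThinTextureCase)
    (h₁ : Theses.InterfaceTextureTrichotomy.TexturedGrainCase) (h₂ : Theses.InterfaceTextureTrichotomy.IrregularGrainCase) (h₃ : Theses.InterfaceTextureTrichotomy.MesoscopicCompositeCase) :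
    Theses.CoarseDensityTrichotomy.CoarseMinorityBulkCase := fun x hx h₂' h₅₀ =>
  (Classical.em _).elim (fun hH => hG x hx hH h₅₀) fun hH =>
    (Classical.em _).elim (fun hT => hA x hx hT h₅₀ hH) fun hT =>
      compositeTextureCase_of_children h₁ h₂ h₃ x hx h₂' h₅₀ hH hT

/-- the conjunct from the refined cell list (the route's deciding theorem with C rebuilt from its children; 8 binders). -/
theorem crystallization_of_children (h_S : Theses.InterfaceTextureTrichotomy.CoarseSparseBulkCase) (h_G : Theses.InterfaceTextureTrichotomy.GrainyTextureCase) (h_A : Theses.InterfaceTextureTrichotomy.ThinTextureCase)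
    (h₁ : Theses.InterfaceTextureTrichotomy.TexturedGrainCase) (h₂ : Theses.InterfaceTextureTrichotomy.IrregularGrainCase) (h₃ : Theses.InterfaceTextureTrichotomy.MesoscopicCompositeCase)
    (h_T : Theses.InterfaceTextureTrichotomy.CoarseMajorityBulkCase) (h_Mat : Theses.InterfaceTextureTrichotomy.MatrixCase) : _root_.Crystallization :=
  Theses.InterfaceTextureTrichotomy.closes h_S h_G h_A (compositeTextureCase_of_children h₁ h₂ h₃) h_T h_Mat

end Summit.AtomisticToContinuum.Crystallization.Theorems.InterfaceTextureTrichotomyNoduleBulk
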